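import Summits.CriticalPhenomena.SAWScalingLimit.Theorems.SAWDevelopingMapObservableToSLETypeLadderCarvedReductionSqueezeContain
import Summits.CriticalPhenomena.SAWScalingLimit.Theorems.SAWDevelopingMapObservableToSLETypeLadderCarvedReductionCell
import Summits.CriticalPhenomena.SAWScalingLimit.Theorems.SAWDefectDecoherenceObservableToSLERTwoPieceAdmIdentificationMesh
import Summits.CriticalPhenomena.SAWScalingLimit.Theorems.SAWDevelopingMapObservableToSLECanonicalTransferFamily
import Summits.CriticalPhenomena.SAWScalingLimit.Theorems.SAWDevelopingMapObservableToSLETypeLadderCarvedReductionSqueezeShadow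
import Literature.Probability.RandomPlanarGeometry.PlanarDomains
import HarnessLib

/-!
# The realised cells of the moving-carving squeeze (piece (T-A cells) of stub T-A
# `stub_carvedReduction_squeezeGeometry`)

Crux `SAWDevelopingMap.ObservableToSLE` (stmt-CriticalPhenomena-10472), line `six-class-type-ladder`,
stub T-A `stub_carvedReduction_squeezeGeometry`.  Landing target:
`Summits/CriticalPhenomena/SAWScalingLimit/Theorems/SAWDevelopingMapObservableToSLETypeLadderCarvedReductionSqueezeCells.lean`
(`--supports stmt-CriticalPhenomena-10472`).

THE PER-INDEX LATTICE CLAUSES of the squeeze (clause (C8) of `MovingCarvingSqueezeP` and the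
eventual block of the squeeze package of `TypeLadder.stub_carvedReduction_ratioSqueeze`).  In the
PINNED FRAME (translation `x_j`, `τ_j = s_j · triEmbed x_j`) the realised gate up-faces are
`q_j = x_j + (g₀(s_j), 0)`, `q'_j = x_j + (g₁(s_j), 0)` with down-faces `p_j`, `p'_j` below them; the
inner family `Λ'` of the inner domain `M` (nested in the outer family `N` of the outer domain `E`,
`…SqueezeNested`) is translated back: `Λ''_j := x_j + Λ'(s_j)`.  From the four GEOMETRIC FACTS of
the pinned frame supplied by the limit analysis — (U) near the pinned gates the removed set `U_j` is
EXACTLY the rows below the gate row, (MD) `M + τ_j` and the `2ρc`-discs about the gates sit in `Ω`,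
(MU) points of `M` away from the gates carry no removed vertex, (R) every vertex of a `U_j`-avoiding
walk of `Ω_δ` from `q_j` is, pinned, CLEARLY DEEP in `E` — and the lattice clauses of the families
(depth of `Λ'`, closure of `N`, exact rows, gate faces), this file derives (`squeeze_cells`),
eventually in `j`: the cell is carved (misses `U_j`), has no bad edge
(`TypeLadder.hexDomainGraph_adj_of_geometry`, p126236: centres in `Ω`, short segments in the deep
discs, connected, contains the domain vertex `q_j`), contains `q_j`; `p_j, p'_j ∈ U_j`; the gate
mid-edges are the translated `a(s_j)`, `b(s_j)` and are distinct; every `U_j`-avoiding walk from `q_j`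
stays in `x_j + N(s_j)` (`TypeLadder.outerContainment`, p134719); the translated `p_j`, `p'_j` are not
in `N(s_j)`.  Registered carrier: `stub_carvedReduction_preconnected_translate`.
-/

noncomputable section

open scoped Topology
open Filter Set Metric
open Literature.Probability.LatticeModels (HexVertex hexGraph hexCenter triEmbed Site)
open Literature.Probability.RandomPlanarGeometry
open Literature.Probability.RandomPlanarGeometry.SAW
open Literature.Probability.Percolation (PathIn)

namespace Summit.CriticalPhenomena.SAWScalingLimit.Theorems.ObservableToSLE.TypeLadder

open Summit.CriticalPhenomena.SAWScalingLimit.Theorems.ObservableToSLE.FloorRatio (hexGraph_adj_below)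
open Summit.CriticalPhenomena.SAWScalingLimit.Theorems.ObservableToSLER.TwoPiece (dist_smul_hexCenter_le_of_adj)

/-! ### Translation bookkeeping -/

/-- Rescaled centre of a vertex translated back by `x`: `δ c_{(-x + y.1, y.2)} = δ c_y - δ · triEmbed x`. -/
theorem smul_hexCenter_neg_translate (δ : ℝ) (x : Site 2) (y : HexVertex) :
    (δ : ℂ) * hexCenter ((-x + y.1, y.2) : HexVertex) = (δ : ℂ) * hexCenter y - (δ : ℂ) * triEmbed x := by
  have h := hexCenter_translate x ((-x + y.1, y.2) : HexVertex)
  have e : ((x + ((-x + y.1, y.2) : HexVertex).1, ((-x + y.1, y.2) : HexVertex).2) : HexVertex) = y := by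
    obtain ⟨c, k⟩ := y; simp
  rw [e] at h
  rw [h]; ring

/-- Rescaled centre of a translated vertex: `δ c_{(x + w.1, w.2)} = δ c_w + δ · triEmbed x`. -/
theorem smul_hexCenter_translate (δ : ℝ) (x : Site 2) (w : HexVertex) :
    (δ : ℂ) * hexCenter ((x + w.1, w.2) : HexVertex) = (δ : ℂ) * hexCenter w + (δ : ℂ) * triEmbed x := by
  rw [hexCenter_translate]; ring

/-- **A translated connected lattice domain is connected.** -/
theorem preconnected_translate (x : Site 2) {Λ Λₓ : Finset HexVertex}
    (hΛ : ∀ w : HexVertex, w ∈ Λₓ ↔ ((-x + w.1, w.2) : HexVertex) ∈ Λ)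
    (hconn : (hexGraph.induce (↑Λ : Set HexVertex)).Preconnected) :
    (hexGraph.induce (↑Λₓ : Set HexVertex)).Preconnected := by
  -- the translation as a graph homomorphism of the induced subgraphs
  set φ : hexGraph.induce (↑Λ : Set HexVertex) →g hexGraph.induce (↑Λₓ : Set HexVertex) :=
    { toFun := fun v => ⟨((x + v.1.1, v.1.2) : HexVertex),
        Finset.mem_coe.2 ((translate_mem_iff x hΛ v.1).2 (Finset.mem_coe.1 v.2))⟩
      map_rel' := fun {a b} h => by
        rw [SimpleGraph.induce_adj] at h ⊢
        exact (hexGraph_adj_translate_iff x a.1 b.1).2 h } with hφ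
  intro a b
  have ha : ((-x + a.1.1, a.1.2) : HexVertex) ∈ Λ := (hΛ a.1).1 (Finset.mem_coe.1 a.2)
  have hb : ((-x + b.1.1, b.1.2) : HexVertex) ∈ Λ := (hΛ b.1).1 (Finset.mem_coe.1 b.2)
  obtain ⟨p⟩ := hconn ⟨_, Finset.mem_coe.2 ha⟩ ⟨_, Finset.mem_coe.2 hb⟩
  have hpa : φ ⟨_, Finset.mem_coe.2 ha⟩ = a := by
    apply Subtype.ext
    change ((x + (-x + a.1.1), a.1.2) : HexVertex) = a.1
    obtain ⟨⟨c, k⟩, _⟩ := a; simp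
  have hpb : φ ⟨_, Finset.mem_coe.2 hb⟩ = b := by
    apply Subtype.ext
    change ((x + (-x + b.1.1), b.1.2) : HexVertex) = b.1
    obtain ⟨⟨c, k⟩, _⟩ := b; simp
  have := (p.map φ).reachable
  rwa [hpa, hpb] at this

/-- **Registered sub-goal `stub_carvedReduction_preconnected_translate`** (crux item
stmt-CriticalPhenomena-10472, stub T-A `stub_carvedReduction_squeezeGeometry`, piece (T-A cells)):
registry form of `preconnected_translate`. -/
theorem stub_carvedReduction_preconnected_translate :
    ∀ (x : Site 2) (Λ Λₓ : Finset HexVertex),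
      (∀ w : HexVertex, w ∈ Λₓ ↔ ((-x + w.1, w.2) : HexVertex) ∈ Λ) →
      (hexGraph.induce (↑Λ : Set HexVertex)).Preconnected →
      (hexGraph.induce (↑Λₓ : Set HexVertex)).Preconnected :=
  fun x _ _ hΛ hconn => preconnected_translate x hΛ hconn

/-! ### The cells -/

/-- **THE REALISED CELLS**; see the module docstring.  Notation: `τ_j = s_j · triEmbed x_j`; the
exempt slabs `X` and the clearly-deep set are those of `…SqueezeFamily` for the gate points `E.pt i`,
box half-width `ρc`, depth `ρc'`, thresholds `g i δ 1`. -/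
theorem squeeze_cells {Ω : Set ℂ} (E M : DobrushinDomain) {s : ℕ → ℝ} {U : ℕ → Set HexVertex}
    {q q' p p' : ℕ → HexVertex} {x : ℕ → Site 2} {N Λ' : ℝ → Finset HexVertex}
    {a b : ℝ → Sym2 HexVertex} {g : Fin 2 → ℝ → Site 2} {ρ' ρc ρc' : ℝ}
    (hs0 : Tendsto s atTop (𝓝[>] 0)) (hρ' : 0 < ρ') (hρc : 0 < ρc)
    -- the pinned gates
    (hq : ∀ j, q j = ((x j + g 0 (s j), 0) : HexVertex))
    (hp : ∀ j, p j = ((x j + (g 0 (s j) - Pi.single 1 1), 1) : HexVertex))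
    (hq' : ∀ j, q' j = ((x j + g 1 (s j), 0) : HexVertex))
    (hp' : ∀ j, p' j = ((x j + (g 1 (s j) - Pi.single 1 1), 1) : HexVertex))
    (hglim : ∀ i, Tendsto (fun j => (s j : ℂ) * hexCenter ((g i (s j), 0) : HexVertex)) atTop (𝓝 (E.pt i)))
    -- the families (from `…SqueezeNested`)
    (ha : ∀ δ, a δ = s(((g 0 δ, 0) : HexVertex), (g 0 δ - Pi.single 1 1, 1)))
    (hb : ∀ δ, b δ = s(((g 1 δ, 0) : HexVertex), (g 1 δ - Pi.single 1 1, 1)))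
    (hinM : ∀ᶠ δ : ℝ in 𝓝[>] 0, (hexGraph.induce (↑(Λ' δ) : Set HexVertex)).Preconnected ∧
      ∀ v ∈ Λ' δ, (δ : ℂ) * hexCenter v ∈ M.carrier)
    (hrows : ∀ᶠ δ : ℝ in 𝓝[>] 0, ∀ (i : Fin 2) (v : HexVertex), (δ : ℂ) * hexCenter v ∈ ball (E.pt i) ρ' →
      (v ∈ Λ' δ ↔ g i δ 1 ≤ v.1 1))
    (hdepth : ∀ᶠ δ : ℝ in 𝓝[>] 0, ∀ v ∈ Λ' δ,
      closedBall ((δ : ℂ) * hexCenter v) (25 * δ) ⊆ M.carrier ∪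
        ⋃ i, {x : ℂ | |x.re - (E.pt i).re| ≤ ρc ∧ (E.pt i).im - 30 * δ ≤ x.im ∧ x.im ≤ (E.pt i).im})
    (hclosed : ∀ᶠ δ : ℝ in 𝓝[>] 0, ∀ z w : HexVertex, z ∈ N δ →
      PathIn hexGraph {u : HexVertex | (δ : ℂ) * hexCenter u ∈ E.carrier ∧
        closedBall ((δ : ℂ) * hexCenter u) (25 * δ) ⊆ E.carrier ∪
          ⋃ i, {x : ℂ | |x.re - (E.pt i).re| ≤ ρc ∧ (E.pt i).im - 30 * δ ≤ x.im ∧ x.im ≤ (E.pt i).im} ∧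
        ∀ i, |((δ : ℂ) * hexCenter u).re - (E.pt i).re| < ρc + 10 * δ →
          |((δ : ℂ) * hexCenter u).im - (E.pt i).im| < ρc' → g i δ 1 ≤ u.1 1} z w → w ∈ N δ)
    (hfaces : ∀ᶠ δ : ℝ in 𝓝[>] 0, ((g 0 δ, 0) : HexVertex) ∈ N δ ∧ ((g 0 δ, 0) : HexVertex) ∈ Λ' δ ∧
      ((g 1 δ, 0) : HexVertex) ∈ N δ ∧ ((g 1 δ, 0) : HexVertex) ∈ Λ' δ ∧
      ((g 0 δ - Pi.single 1 1, 1) : HexVertex) ∉ N δ ∧ ((g 1 δ - Pi.single 1 1, 1) : HexVertex) ∉ N δ ∧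
      a δ ≠ b δ)
    -- the geometric facts of the pinned frame
    (hU : ∀ᶠ j in atTop, ∀ (i : Fin 2) (v : HexVertex),
      (s j : ℂ) * hexCenter v - (s j : ℂ) * triEmbed (x j) ∈ ball (E.pt i) ρ' →
        (v ∈ U j ↔ v.1 1 < x j 1 + g i (s j) 1))
    (hMD : ∀ᶠ j in atTop, ∀ z : ℂ, (z ∈ M.carrier ∨ ∃ i, dist z (E.pt i) ≤ 2 * ρc) →
      z + (s j : ℂ) * triEmbed (x j) ∈ Ω)
    (hMU : ∀ᶠ j in atTop, ∀ v : HexVertex,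
      (s j : ℂ) * hexCenter v - (s j : ℂ) * triEmbed (x j) ∈ M.carrier →
        (∀ i, ρ' ≤ dist ((s j : ℂ) * hexCenter v - (s j : ℂ) * triEmbed (x j)) (E.pt i)) → v ∉ U j)
    (hreach : ∀ᶠ j in atTop, ∀ (w : HexVertex) (π : (hexDomainGraph Ω (s j)).Walk (q j) w),
      (∀ y ∈ π.support, y ∉ U j) → ∀ y ∈ π.support,
        ((-(x j) + y.1, y.2) : HexVertex) ∈ {u : HexVertex | ((s j : ℝ) : ℂ) * hexCenter u ∈ E.carrier ∧
          closedBall (((s j : ℝ) : ℂ) * hexCenter u) (25 * s j) ⊆ E.carrier ∪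
            ⋃ i, {x : ℂ | |x.re - (E.pt i).re| ≤ ρc ∧ (E.pt i).im - 30 * s j ≤ x.im ∧ x.im ≤ (E.pt i).im} ∧
          ∀ i, |(((s j : ℝ) : ℂ) * hexCenter u).re - (E.pt i).re| < ρc + 10 * s j →
            |(((s j : ℝ) : ℂ) * hexCenter u).im - (E.pt i).im| < ρc' → g i (s j) 1 ≤ u.1 1})
    (hqdom : ∀ j, q j ∈ embMeshDomain hexGraph hexCenter Ω (s j)) :
    ∃ Λ'' : ℕ → Finset HexVertex,
      (∀ j (w : HexVertex), w ∈ Λ'' j ↔ ((-(x j) + w.1, w.2) : HexVertex) ∈ Λ' (s j)) ∧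
      ∀ᶠ j in atTop,
        (∀ w ∈ Λ'' j, w ∉ U j) ∧
        (∀ w ∈ Λ'' j, ∀ y ∈ Λ'' j, hexGraph.Adj w y → (hexDomainGraph Ω (s j)).Adj w y) ∧
        q j ∈ Λ'' j ∧ p j ∈ U j ∧ p' j ∈ U j ∧ hexGraph.Adj (q j) (p j) ∧
        s(q j, p j) ≠ s(q' j, p' j) ∧
        (a (s j)).map (fun w : HexVertex => ((x j + w.1, w.2) : HexVertex)) = s(q j, p j) ∧
        (b (s j)).map (fun w : HexVertex => ((x j + w.1, w.2) : HexVertex)) = s(q' j, p' j) ∧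
        (∀ (w : HexVertex) (π : (hexDomainGraph Ω (s j)).Walk (q j) w),
          (∀ y ∈ π.support, y ∉ U j) → ∀ y ∈ π.support, ((-(x j) + y.1, y.2) : HexVertex) ∈ N (s j)) ∧
        ((-(x j) + (p j).1, (p j).2) : HexVertex) ∉ N (s j) ∧
        ((-(x j) + (p' j).1, (p' j).2) : HexVertex) ∉ N (s j) := by
  classical
  -- the cells and their description
  set Λ'' : ℕ → Finset HexVertex := fun j =>
    (Λ' (s j)).image fun w : HexVertex => ((x j + w.1, w.2) : HexVertex) with hΛ''
  have hmem : ∀ j (w : HexVertex), w ∈ Λ'' j ↔ ((-(x j) + w.1, w.2) : HexVertex) ∈ Λ' (s j) := by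
    intro j w
    simp only [hΛ'', Finset.mem_image]
    constructor
    · rintro ⟨u, hu, rfl⟩
      obtain ⟨c, k⟩ := u
      simpa using hu
    · intro h
      refine ⟨_, h, ?_⟩
      obtain ⟨c, k⟩ := w; simp
  refine ⟨Λ'', hmem, ?_⟩
  -- meshes are eventually positive and small
  have hspos : ∀ᶠ j in atTop, 0 < s j := hs0.eventually self_mem_nhdsWithin
  have hsmall : ∀ᶠ j in atTop, s j < ρc / 30 :=
    hs0.eventually (mem_nhdsWithin_of_mem_nhds (Iio_mem_nhds (by positivity)))
  -- the down-faces approach the gates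
  have hpnear : ∀ i, ∀ᶠ j in atTop,
      (s j : ℂ) * hexCenter ((g i (s j) - Pi.single 1 1, 1) : HexVertex) ∈ ball (E.pt i) ρ' := by
    intro i
    have h1 : ∀ᶠ j in atTop, dist ((s j : ℂ) * hexCenter ((g i (s j), 0) : HexVertex)) (E.pt i) < ρ' / 2 :=
      hglim i (ball_mem_nhds _ (by positivity))
    have h2 : ∀ᶠ j in atTop, s j < ρ' / 2 :=
      hs0.eventually (mem_nhdsWithin_of_mem_nhds (Iio_mem_nhds (by positivity)))
    filter_upwards [h1, h2, hspos] with j hj hsj hs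
    rw [mem_ball]
    calc dist ((s j : ℂ) * hexCenter ((g i (s j) - Pi.single 1 1, 1) : HexVertex)) (E.pt i)
        ≤ dist ((s j : ℂ) * hexCenter ((g i (s j) - Pi.single 1 1, 1) : HexVertex))
            ((s j : ℂ) * hexCenter ((g i (s j), 0) : HexVertex)) +
          dist ((s j : ℂ) * hexCenter ((g i (s j), 0) : HexVertex)) (E.pt i) := dist_triangle _ _ _
      _ < s j + ρ' / 2 := by
          refine add_lt_add_of_le_of_lt ?_ hj
          rw [dist_comm]
          exact dist_smul_hexCenter_le_of_adj hs.le (hexGraph_adj_below _)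
      _ < ρ' := by linarith
  filter_upwards [hspos, hsmall, hpnear 0, hpnear 1, hs0.eventually hinM, hs0.eventually hrows,
    hs0.eventually hdepth, hs0.eventually hclosed, hs0.eventually hfaces, hU, hMD, hMU, hreach]
    with j hsj hsmallj hp0 hp1 hinMj hrowsj hdepthj hclosedj hfacesj hUj hMDj hMUj hreachj
  obtain ⟨hconnL, hinML⟩ := hinMj
  obtain ⟨hg0N, hg0L, hg1N, hg1L, hd0N, hd1N, hab⟩ := hfacesj
  set τj : ℂ := (s j : ℂ) * triEmbed (x j) with hτj
  -- translated members: in `Λ'`, centre `= pinned centre + τ_j`, pinned centre in `M`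
  have hback : ∀ w ∈ Λ'' j, ((-(x j) + w.1, w.2) : HexVertex) ∈ Λ' (s j) ∧
      (s j : ℂ) * hexCenter w = (s j : ℂ) * hexCenter ((-(x j) + w.1, w.2) : HexVertex) + τj ∧
      (s j : ℂ) * hexCenter ((-(x j) + w.1, w.2) : HexVertex) ∈ M.carrier := by
    intro w hw
    have h1 := (hmem j w).1 hw
    refine ⟨h1, ?_, hinML _ h1⟩
    rw [smul_hexCenter_neg_translate]; ring
  -- (3) the cell misses `U_j`
  have hmiss : ∀ w ∈ Λ'' j, w ∉ U j := by
    intro w hw hwU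
    obtain ⟨hwL, hctr, hwM⟩ := hback w hw
    have hpin : (s j : ℂ) * hexCenter w - τj = (s j : ℂ) * hexCenter ((-(x j) + w.1, w.2) : HexVertex) := by
      rw [hctr]; ring
    by_cases hnear : ∃ i, (s j : ℂ) * hexCenter ((-(x j) + w.1, w.2) : HexVertex) ∈ ball (E.pt i) ρ'
    · obtain ⟨i, hi⟩ := hnear
      have hrow := (hrowsj i _ hi).1 hwL
      have hUi := (hUj i w (by rw [hpin]; exact hi)).1 hwU
      have : ((-(x j) + w.1, w.2) : HexVertex).1 1 = -(x j 1) + w.1 1 := by simp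
      rw [this] at hrow
      linarith [(show ((((-(x j) + w.1, w.2) : HexVertex).1 1 : ℤ) : ℤ) = -(x j 1) + w.1 1 from this)]
    · push Not at hnear
      refine hMUj w (by rw [hpin]; exact hwM) (fun i => ?_) hwU
      rw [hpin]
      exact not_lt.1 fun h => hnear i (mem_ball.2 h)
  -- (5) the gate vertex, (6) the down-faces, (11) translated down-faces
  have hqmem : q j ∈ Λ'' j := by
    rw [hmem, hq j]; simpa using hg0L
  have hpctr : ∀ (i : Fin 2) (y : Site 2), (s j : ℂ) * hexCenter ((x j + y, 1) : HexVertex) - τj =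
      (s j : ℂ) * hexCenter ((y, 1) : HexVertex) := by
    intro i y
    have := smul_hexCenter_translate (s j) (x j) ((y, 1) : HexVertex)
    simp only at this
    rw [this]; ring
  have hpU : p j ∈ U j := by
    refine (hUj 0 (p j) ?_).2 ?_
    · rw [hp j, hpctr 0]; exact hp0
    · rw [hp j]; simp
  have hp'U : p' j ∈ U j := by
    refine (hUj 1 (p' j) ?_).2 ?_
    · rw [hp' j, hpctr 1]; exact hp1
    · rw [hp' j]; simp
  have hpN : ((-(x j) + (p j).1, (p j).2) : HexVertex) ∉ N (s j) := by
    rw [hp j]; simpa using hd0N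
  have hp'N : ((-(x j) + (p' j).1, (p' j).2) : HexVertex) ∉ N (s j) := by
    rw [hp' j]; simpa using hd1N
  -- (7) adjacency and (9) the gate mid-edges
  have hadj : hexGraph.Adj (q j) (p j) := by
    rw [hq j, hp j]
    have := (hexGraph_adj_translate_iff (x j) ((g 0 (s j), 0) : HexVertex)
      ((g 0 (s j) - Pi.single 1 1, 1) : HexVertex)).2 (hexGraph_adj_below _)
    simpa using this
  have hamap : (a (s j)).map (fun w : HexVertex => ((x j + w.1, w.2) : HexVertex)) = s(q j, p j) := by
    rw [ha, Sym2.map_mk, hq j, hp j]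
  have hbmap : (b (s j)).map (fun w : HexVertex => ((x j + w.1, w.2) : HexVertex)) = s(q' j, p' j) := by
    rw [hb, Sym2.map_mk, hq' j, hp' j]
  -- (8) the two gate mid-edges are distinct
  have hne : s(q j, p j) ≠ s(q' j, p' j) := by
    intro h
    apply hab
    have h2 := congrArg (Sym2.map fun w : HexVertex => ((-(x j) + w.1, w.2) : HexVertex))
      (hamap.trans (h.trans hbmap.symm))
    rwa [sym2_map_translate_neg_translate, sym2_map_translate_neg_translate] at h2
  -- (4) no bad edge
  have hΩΛ : ∀ w ∈ Λ'' j, (s j : ℂ) * hexCenter w ∈ Ω := by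
    intro w hw
    obtain ⟨-, hctr, hwM⟩ := hback w hw
    rw [hctr]
    exact hMDj _ (Or.inl hwM)
  have hseg : ∀ w ∈ Λ'' j, ∀ y ∈ Λ'' j, hexGraph.Adj w y →
      segment ℝ ((s j : ℂ) * hexCenter w) ((s j : ℂ) * hexCenter y) ⊆ closure Ω := by
    intro w hw y hy hwy z hz
    obtain ⟨hwL, hctr, hwM⟩ := hback w hw
    refine subset_closure ?_
    -- the segment lies in the closed `25 s_j`-disc about the centre of `w`
    have hzball : z ∈ closedBall ((s j : ℂ) * hexCenter w) (25 * s j) := by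
      refine (convex_closedBall _ _).segment_subset (mem_closedBall_self (by positivity)) ?_ hz
      rw [mem_closedBall, dist_comm]
      exact (dist_smul_hexCenter_le_of_adj hsj.le hwy).trans (by linarith)
    -- pinned, it lies in the deep disc of the translated vertex
    have hz' : z - τj ∈ closedBall ((s j : ℂ) * hexCenter ((-(x j) + w.1, w.2) : HexVertex)) (25 * s j) := by
      rw [mem_closedBall] at hzball ⊢
      rw [hctr] at hzball
      calc dist (z - τj) ((s j : ℂ) * hexCenter ((-(x j) + w.1, w.2) : HexVertex))
          = dist z ((s j : ℂ) * hexCenter ((-(x j) + w.1, w.2) : HexVertex) + τj) := by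
            rw [dist_eq_norm, dist_eq_norm]; congr 1; ring
        _ ≤ 25 * s j := hzball
    have hz'' := hdepthj _ hwL hz'
    have hzeq : z = (z - τj) + τj := by ring
    rw [hzeq]
    refine hMDj (z - τj) ?_
    rcases hz'' with h | h
    · exact Or.inl h
    · obtain ⟨i, hi1, hi2, hi3⟩ := mem_iUnion.1 h
      refine Or.inr ⟨i, ?_⟩
      calc dist (z - τj) (E.pt i) ≤ |((z - τj) - E.pt i).re| + |((z - τj) - E.pt i).im| :=
            dist_le_abs_re_add_abs_im _ _
        _ ≤ ρc + 30 * s j := by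
            rw [Complex.sub_re, Complex.sub_im]
            refine add_le_add hi1 ?_
            rw [abs_le]; constructor <;> linarith
        _ ≤ 2 * ρc := by linarith
  have hconn'' : (hexGraph.induce (↑(Λ'' j) : Set HexVertex)).Preconnected :=
    preconnected_translate (x j) (hmem j) hconnL
  have hnobad : ∀ w ∈ Λ'' j, ∀ y ∈ Λ'' j, hexGraph.Adj w y → (hexDomainGraph Ω (s j)).Adj w y :=
    hexDomainGraph_adj_of_geometry hΩΛ hseg hconn'' hqmem (hqdom j)
  -- (10) outer containment
  have hqN : ((-(x j) + (q j).1, (q j).2) : HexVertex) ∈ (↑(N (s j)) : Set HexVertex) := by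
    rw [hq j]; simpa using hg0N
  have hcont : ∀ (w : HexVertex) (π : (hexDomainGraph Ω (s j)).Walk (q j) w),
      (∀ y ∈ π.support, y ∉ U j) → ∀ y ∈ π.support, ((-(x j) + y.1, y.2) : HexVertex) ∈ N (s j) := by
    intro w π hπ y hy
    have := outerContainment (N := (↑(N (s j)) : Set HexVertex))
      (fun z w' hz hzw => Finset.mem_coe.2 (hclosedj z w' (Finset.mem_coe.1 hz) hzw)) hqN hreachj w π hπ y hy
    exact Finset.mem_coe.1 this
  exact ⟨hmiss, hnobad, hqmem, hpU, hp'U, hadj, hne, hamap, hbmap, hcont, hpN, hp'N⟩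

end Summit.CriticalPhenomena.SAWScalingLimit.Theorems.ObservableToSLE.TypeLadder

end
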